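import Literature.Analysis.Fourier.HilbertTransformLine
import Mathlib.MeasureTheory.Group.Integral
import Mathlib.MeasureTheory.Measure.Lebesgue.Integral
import Mathlib.MeasureTheory.Integral.IntervalIntegral.Basic
import HarnessLib

/-!
# The moment formula (commutator with `x`) of the Hilbert transform on the line

Topic `Literature/Analysis/Fourier`. For the p.v. Hilbert transform `H` of
`Literature/Analysis/Fourier/HilbertTransformLine.lean` (convention `H sin = −cos`) and an integrable `f` whose
symmetric integrand at `x` is integrable, the **moment formula**

  `H[y f(y)](x) = x · Hf(x) − π⁻¹ ∫_ℝ f`        [cite: King2009HilbertTransforms2, eq. (19.150) (= Vol. 1 eq. (4.111))]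

holds; in particular `H(y f) = x·Hf` whenever `∫ f = 0`, e.g. for every ODD integrable `f`
[cite: King2009HilbertTransforms2, eq. (19.151) and (19.270)]. This is the identity behind the exact isometry of `H` on the
odd part of the weighted space `L²(2 + ξ²)` used in the SHEET-ℝ certificate frame (cell ns-blowup, HOME/selfsim/SHEET-R-FRAME-NOTE-v2.md
§1): `‖ξ·Hf‖ = ‖H(ξf)‖ = ‖ξf‖` once `H` is an `L²` isometry.

Proof: the symmetric integrand of `y f(y)` at `x` is `x·(f(x−t) − f(x+t))/t − (f(x−t) + f(x+t))` for `t ≠ 0`, and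
`∫_{t>0} f(x−t) dt + ∫_{t>0} f(x+t) dt = ∫_{s ≤ x} f + ∫_{s > x} f = ∫_ℝ f` (translation and reflection invariance of
Lebesgue measure). No new definition.
-/

namespace Literature.Analysis.Fourier

open _root_.MeasureTheory Set Filter
open scoped Real Topology

/-- `∫_{t>0} f(x + t) dt = ∫_{s>x} f(s) ds`. [folklore] -/
private theorem integral_Ioi_comp_const_add (f : ℝ → ℝ) (x : ℝ) :
    ∫ t in Ioi (0 : ℝ), f (x + t) = ∫ s in Ioi x, f s := by
  rw [← integral_indicator measurableSet_Ioi, ← integral_indicator measurableSet_Ioi]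
  have h : (fun t => (Ioi (0 : ℝ)).indicator (fun t => f (x + t)) t) = fun t => (Ioi x).indicator f (x + t) := by
    funext t
    simp only [Set.indicator_apply, Set.mem_Ioi]
    split_ifs with h1 h2 h2
    · rfl
    · exact absurd (by linarith : x < x + t) h2
    · exact absurd (by linarith : (0 : ℝ) < t) h1
    · rfl
  rw [h]
  exact integral_add_left_eq_self (fun s => (Ioi x).indicator f s) x

/-- `∫_{t>0} f(x − t) dt = ∫_{s ≤ x} f(s) ds`. [folklore] -/
private theorem integral_Ioi_comp_const_sub (f : ℝ → ℝ) (x : ℝ) :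
    ∫ t in Ioi (0 : ℝ), f (x - t) = ∫ s in Iic x, f s := by
  have h1 : ∫ t in Ioi (0 : ℝ), f (x - t) = ∫ t in Ioi (0 : ℝ), (fun s => f (x + s)) (-t) := by
    refine setIntegral_congr_fun measurableSet_Ioi fun t _ => ?_
    simp only [sub_eq_add_neg]
  rw [h1, integral_comp_neg_Ioi 0 (fun s => f (x + s)), neg_zero,
    ← integral_indicator measurableSet_Iic, ← integral_indicator measurableSet_Iic]
  have h : (fun t => (Iic (0 : ℝ)).indicator (fun s => f (x + s)) t) = fun t => (Iic x).indicator f (x + t) := by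
    funext t
    simp only [Set.indicator_apply, Set.mem_Iic]
    split_ifs with h1 h2 h2
    · rfl
    · exact absurd (by linarith : x + t ≤ x) h2
    · exact absurd (by linarith : t ≤ (0 : ℝ)) h1
    · rfl
  rw [h]
  exact integral_add_left_eq_self (fun s => (Iic x).indicator f s) x

/-- For integrable `f`: `∫_{t>0} (f(x − t) + f(x + t)) dt = ∫_ℝ f`. [folklore] -/
private theorem integral_Ioi_symm_add {f : ℝ → ℝ} (hf : Integrable f) (x : ℝ) :
    ∫ t in Ioi (0 : ℝ), (f (x - t) + f (x + t)) = ∫ y, f y := by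
  have hA : Integrable (fun t => f (x - t)) := hf.comp_sub_left x
  have hB : Integrable (fun t => f (x + t)) := hf.comp_add_left x
  rw [integral_add hA.integrableOn hB.integrableOn, integral_Ioi_comp_const_sub, integral_Ioi_comp_const_add]
  exact intervalIntegral.integral_Iic_add_Ioi hf.integrableOn hf.integrableOn

/-- **Moment formula / commutator with `x`:** for `f` integrable on `ℝ` whose symmetric Hilbert integrand at `x` is
integrable on `(0, ∞)`,
`H[y·f(y)](x) = x·Hf(x) − π⁻¹ ∫_ℝ f`. [cite: King2009HilbertTransforms2, eq. (19.150) (moment formula; = Vol. 1 eq. (4.111))] -/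
theorem hilbertTransform_mul_id {f : ℝ → ℝ} {x : ℝ} (hf : Integrable f)
    (hint : IntegrableOn (fun t => (f (x - t) - f (x + t)) / t) (Ioi 0)) :
    hilbertTransform (fun y => y * f y) x = x * hilbertTransform f x - π⁻¹ * ∫ y, f y := by
  unfold hilbertTransform
  have hcongr : ∫ t in Ioi (0 : ℝ), ((x - t) * f (x - t) - (x + t) * f (x + t)) / t =
      ∫ t in Ioi (0 : ℝ), (x * ((f (x - t) - f (x + t)) / t) - (f (x - t) + f (x + t))) := by
    refine setIntegral_congr_fun measurableSet_Ioi fun t ht => ?_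
    have ht0 : t ≠ 0 := ne_of_gt ht
    field_simp
    ring
  have hA : Integrable (fun t => f (x - t)) := hf.comp_sub_left x
  have hB : Integrable (fun t => f (x + t)) := hf.comp_add_left x
  have hAB : Integrable (fun t => f (x - t) + f (x + t)) := hA.add hB
  have hxg : IntegrableOn (fun t => x * ((f (x - t) - f (x + t)) / t)) (Ioi 0) := hint.const_mul x
  rw [hcongr, integral_sub hxg hAB.integrableOn, integral_const_mul, integral_Ioi_symm_add hf x]
  ring

/-- **Mean-zero case:** if moreover `∫_ℝ f = 0` then `H` commutes with multiplication by `x` on `f`: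
`H[y·f(y)](x) = x·Hf(x)`. [cite: King2009HilbertTransforms2, eq. (19.270)] -/
theorem hilbertTransform_mul_id_of_integral_zero {f : ℝ → ℝ} {x : ℝ} (hf : Integrable f)
    (hint : IntegrableOn (fun t => (f (x - t) - f (x + t)) / t) (Ioi 0)) (h0 : ∫ y, f y = 0) :
    hilbertTransform (fun y => y * f y) x = x * hilbertTransform f x := by
  rw [hilbertTransform_mul_id hf hint, h0, mul_zero, sub_zero]

/-- **Odd case** (the SHEET-ℝ frame's isometry mechanism): for an ODD integrable `f` (with integrable symmetric integrand at
`x`), `H[y·f(y)](x) = x·Hf(x)` — so on odd functions `H` commutes with the weight `ξ`, whence `‖Hf‖_{L²(c+ξ²)} = ‖f‖_{L²(c+ξ²)}`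
once `H` is an `L²`-isometry. [cite: King2009HilbertTransforms2, eq. (19.151) (odd/even reduction of the moment formula)] -/
theorem hilbertTransform_mul_id_of_odd {f : ℝ → ℝ} {x : ℝ} (hf : Integrable f) (hodd : ∀ y, f (-y) = -f y)
    (hint : IntegrableOn (fun t => (f (x - t) - f (x + t)) / t) (Ioi 0)) :
    hilbertTransform (fun y => y * f y) x = x * hilbertTransform f x := by
  refine hilbertTransform_mul_id_of_integral_zero hf hint ?_
  -- an odd integrable function has integral zero: `∫ f = ∫ f(−y) dy = −∫ f`
  have h1 : ∫ y, f y = ∫ y, f (-y) := (integral_neg_eq_self f volume).symm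
  have h2 : ∫ y, f (-y) = -∫ y, f y := by
    simp_rw [hodd]
    exact integral_neg f
  linarith

end Literature.Analysis.Fourier
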